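import Literature.Analysis.FluidPDE.ParallelShearFlow
import HarnessLib

/-!
# The parallel-shear slot, family file: polynomial heat-profile shear flows are exact unforced
# Navier–Stokes solutions (Acheson 1990 §2.3 (2.8)–(2.9); Majda–Bertozzi 2002 §1.2)

Support file (all results proved, standard axioms; no definitions) of the barrier catalogue entry
`Literature.Barriers.NavierStokesRegularity.ParallelShearSlot` (file `ParallelShearSlot.lean`, which
carries the structured BARRIER block, the printed sources and the cell rows it bears on); sibling of
`GalileanFrameSlotFamily.lean`. On `ℝ³`, for every viscosity `ν` and all reals `c, d, s, t₀`, the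
plane parallel shear flow `u(t, x) = φ(t, x₁) e₀`, `p ≡ 0`, with the POLYNOMIAL HEAT PROFILE
`φ(t, y) = c + d y + (s/2) y² + ν s (t − t₀)` (an exact solution of `φ_t = ν φ_yy`) is an unforced
classical Navier–Stokes solution on every time set of unique differentiability (tree
`ParallelShear.isClassicalNSSolutionOn_shear`, Acheson §2.3: `isClassicalNSSolutionOn_heatPolyShear`).
At `(t₀, 0)` it realises the values `u = c e₀`, `∂ₜu = ν s e₀`, `(u·∇)u = 0`, `Δu = s e₀`,
`∇p = 0`, `∇(|u|²/2) = c d e₁`, `Du = d (e₀ ⊗ e₁*)`, `p = 0`, `∂ₜp = 0`, with `c, d, s` FREE — so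
`∂ₜu = νΔu ≠ 0` while the convective and pressure terms vanish. Hence THE SHEAR SLOT `shearSlot`:
a relation among `(u, ∂ₜu, (u·∇)u, Δu, ∇p, ∇(|u|²/2), Du, p, ∂ₜp)` asserted pointwise for ALL unforced
classical solutions must hold at `(c e₀, ν s e₀, 0, s e₀, 0, c d e₁, d (e₀ ⊗ e₁*), 0, 0)`;
corollaries by shape: `no_componentwise_heat_law` (no law `∂ₜuᵢ = β ∂ᵢ∂ᵢuᵢ`),
`no_pressureless_energy_transport` (no law `∂ₜ(½|u|² + p) + u·∇(½|u|² + p) = −ν|∇u|²`),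
`laplacian_term_not_slaved_to_convection` (no law tying `νΔu` to `(u·∇)u`, `∇p`, `∇|u|²` alone).

## References

* [Acheson1990] D. J. Acheson, *Elementary Fluid Dynamics*, OUP 1990, §2.3 eqs. (2.8)–(2.9) (plane
  parallel shear flow reduces Navier–Stokes to the one-dimensional heat equation).
* [MajdaBertozzi2002] A. J. Majda, A. L. Bertozzi, *Vorticity and Incompressible Flow*, CUP 2002,
  §1.2 (elementary exact solutions: shear flows).

WHAT THIS IS NOT: not a claim about NS regularity or blow-up; not a claim about any author beyond the
typed locator.
-/

noncomputable section

open Set Function InnerProductSpace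
open scoped ContDiff Laplacian RealInnerProductSpace

namespace Literature.Barriers.NavierStokesRegularity

open Literature.Analysis.FluidPDE Literature.Analysis.FluidPDE.ParallelShear

namespace ShearSlot

/-! ### The polynomial heat profile and its shear flow -/

/-- The stream-wise zero force is the zero force. [cite: Acheson1990, §2.3 eq. (2.9)] -/
theorem shearForce_zero : shearForce (fun _ _ => (0 : ℝ)) = 0 := by
  funext t x
  simp [shearForce]

/-- The pressure `shearPressure 0` is identically zero. [cite: Acheson1990, §2.3 eq. (2.9)] -/
theorem shearPressure_zero_apply (t : ℝ) (x : E3) : shearPressure (fun _ => (0 : ℝ)) t x = 0 := by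
  simp [shearPressure]

/-- The polynomial heat profile `φ(t, y) = c + d y + (s/2) y² + ν s (t − t₀)` is jointly smooth.
[cite: Acheson1990, §2.3 eq. (2.9)] -/
theorem contDiff_heatPoly (ν c d s t₀ : ℝ) :
    ContDiff ℝ ∞ (uncurry fun t y : ℝ => c + d * y + s / 2 * y ^ 2 + ν * s * (t - t₀)) := by
  have : (uncurry fun t y : ℝ => c + d * y + s / 2 * y ^ 2 + ν * s * (t - t₀)) =
      fun q : ℝ × ℝ => c + d * q.2 + s / 2 * q.2 ^ 2 + ν * s * (q.1 - t₀) := by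
    funext q; rfl
  rw [this]
  fun_prop

/-- Spatial derivative of the profile: `φ_y(t, y) = d + s y`. [cite: Acheson1990, §2.3 eq. (2.9)] -/
theorem hasDerivAt_heatPoly_space (ν c d s t₀ t y : ℝ) :
    HasDerivAt (fun z : ℝ => c + d * z + s / 2 * z ^ 2 + ν * s * (t - t₀)) (d + s * y) y := by
  have h1 : HasDerivAt (fun z : ℝ => d * z) (d * 1) y := (hasDerivAt_id y).const_mul d
  have h2 : HasDerivAt (fun z : ℝ => s / 2 * z ^ 2) (s / 2 * ((2 : ℕ) * y ^ (2 - 1))) y :=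
    (hasDerivAt_pow 2 y).const_mul (s / 2)
  have h := ((h1.const_add c).add h2).add_const (ν * s * (t - t₀))
  refine h.congr_deriv ?_
  push_cast
  ring

/-- `deriv (φ t) = fun y => d + s y`. [cite: Acheson1990, §2.3 eq. (2.9)] -/
theorem deriv_heatPoly_space (ν c d s t₀ t : ℝ) :
    deriv (fun z : ℝ => c + d * z + s / 2 * z ^ 2 + ν * s * (t - t₀)) = fun y => d + s * y :=
  funext fun y => (hasDerivAt_heatPoly_space ν c d s t₀ t y).deriv

/-- `deriv (deriv (φ t)) = fun _ => s`. [cite: Acheson1990, §2.3 eq. (2.9)] -/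
theorem deriv_deriv_heatPoly_space (ν c d s t₀ t : ℝ) :
    deriv (deriv (fun z : ℝ => c + d * z + s / 2 * z ^ 2 + ν * s * (t - t₀))) = fun _ => s := by
  rw [deriv_heatPoly_space]
  funext y
  have h : HasDerivAt (fun z : ℝ => d + s * z) (s * 1) y := ((hasDerivAt_id y).const_mul s).const_add d
  rw [h.deriv, mul_one]

/-- Time derivative of the profile within any time set at a point of unique differentiability:
`φ_t = ν s`. [cite: Acheson1990, §2.3 eq. (2.9)] -/
theorem derivWithin_heatPoly_time {S : Set ℝ} {t : ℝ} (hS : UniqueDiffWithinAt ℝ S t)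
    (ν c d s t₀ y : ℝ) :
    derivWithin (fun τ : ℝ => c + d * y + s / 2 * y ^ 2 + ν * s * (τ - t₀)) S t = ν * s := by
  have h : HasDerivAt (fun τ : ℝ => c + d * y + s / 2 * y ^ 2 + ν * s * (τ - t₀)) (ν * s * 1) t :=
    (((hasDerivAt_id t).sub_const t₀).const_mul (ν * s)).const_add _
  rw [mul_one] at h
  exact h.hasDerivWithinAt.derivWithin hS

/-- **The polynomial heat-profile shear flow is an exact unforced classical Navier–Stokes solution**
on every time set `S` of unique differentiability, for all `ν, c, d, s, t₀`:
`u(t, x) = (c + d x₁ + (s/2) x₁² + ν s (t − t₀)) e₀`, `p ≡ 0` (Acheson (2.9) with `∂ₓp = 0`,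
`φ_t = ν φ_yy`). [cite: Acheson1990, §2.3 eqs. (2.8)–(2.9)] -/
theorem isClassicalNSSolutionOn_heatPolyShear {S : Set ℝ} (hS : UniqueDiffOn ℝ S) (ν c d s t₀ : ℝ) :
    IsClassicalNSSolutionOn S ν 0
      (shearVelocity fun t y => c + d * y + s / 2 * y ^ 2 + ν * s * (t - t₀))
      (shearPressure fun _ => 0) := by
  have h := isClassicalNSSolutionOn_shear hS (ν := ν) (g := fun _ _ => (0 : ℝ)) (G := fun _ => (0 : ℝ))
    ((contDiff_heatPoly ν c d s t₀).contDiffOn) contDiffOn_const (fun t ht y => by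
      rw [derivWithin_heatPoly_time (hS t ht), deriv_deriv_heatPoly_space]
      ring)
  rwa [shearForce_zero] at h

/-! ### Values realised at `(t₀, 0)` -/

/-- The velocity value at `x₁ = y`: `u(t, x) = φ(t, x₁) e₀`; at `(t₀, 0)` it is `c e₀`.
[cite: Acheson1990, §2.3 eq. (2.8)] -/
theorem heatPolyShear_apply_origin (ν c d s t₀ : ℝ) :
    shearVelocity (fun t y => c + d * y + s / 2 * y ^ 2 + ν * s * (t - t₀)) t₀ 0 =
      c • EuclideanSpace.single (0 : Fin 3) (1 : ℝ) := by
  simp [shearVelocity]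

/-- `∂ₜu(t₀, x) = ν s e₀` (within `S`, at a point of unique differentiability).
[cite: Acheson1990, §2.3 eq. (2.9)] -/
theorem timeDerivWithin_heatPolyShear {S : Set ℝ} {t : ℝ} (hS : UniqueDiffWithinAt ℝ S t)
    (ν c d s t₀ : ℝ) (x : E3) :
    timeDerivWithin S (shearVelocity fun τ y => c + d * y + s / 2 * y ^ 2 + ν * s * (τ - t₀)) t x =
      (ν * s) • EuclideanSpace.single (0 : Fin 3) (1 : ℝ) := by
  rw [timeDerivWithin_apply]
  have h : HasDerivAt (fun τ : ℝ => c + d * x 1 + s / 2 * x 1 ^ 2 + ν * s * (τ - t₀)) (ν * s * 1) t :=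
    (((hasDerivAt_id t).sub_const t₀).const_mul (ν * s)).const_add _
  rw [mul_one] at h
  exact (h.smul_const (EuclideanSpace.single (0 : Fin 3) (1 : ℝ))).hasDerivWithinAt.derivWithin hS

/-- `(u·∇)u = 0` everywhere along the family. [cite: Acheson1990, §2.3 eq. (2.9)] -/
theorem convect_heatPolyShear (ν c d s t₀ t : ℝ) (x : E3) :
    convect (shearVelocity (fun τ y => c + d * y + s / 2 * y ^ 2 + ν * s * (τ - t₀)) t)
      (shearVelocity (fun τ y => c + d * y + s / 2 * y ^ 2 + ν * s * (τ - t₀)) t) x = 0 :=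
  convect_profile (hasDerivAt_heatPoly_space ν c d s t₀ t (x 1)).differentiableAt

/-- `Δu(t, x) = s e₀` everywhere along the family. [cite: Acheson1990, §2.3 eq. (2.9)] -/
theorem laplacian_heatPolyShear (ν c d s t₀ t : ℝ) (x : E3) :
    Δ (shearVelocity (fun τ y => c + d * y + s / 2 * y ^ 2 + ν * s * (τ - t₀)) t) x =
      s • EuclideanSpace.single (0 : Fin 3) (1 : ℝ) := by
  have hφ : ContDiff ℝ 2 (fun z : ℝ => c + d * z + s / 2 * z ^ 2 + ν * s * (t - t₀)) := by fun_prop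
  have h := laplacian_profile hφ x
  rw [deriv_deriv_heatPoly_space] at h
  exact h

/-- `Du(t, x) = (d + s x₁) (e₀ ⊗ e₁*)`; at `x₁ = 0` the shear rate is `d`.
[cite: Acheson1990, §2.3 eq. (2.8)] -/
theorem fderiv_heatPolyShear (ν c d s t₀ t : ℝ) (x : E3) :
    fderiv ℝ (shearVelocity (fun τ y => c + d * y + s / 2 * y ^ 2 + ν * s * (τ - t₀)) t) x =
      (EuclideanSpace.proj (1 : Fin 3) : E3 →L[ℝ] ℝ).smulRight
        ((d + s * x 1) • EuclideanSpace.single (0 : Fin 3) (1 : ℝ)) := by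
  have h := fderiv_profile (ψ := fun z : ℝ => c + d * z + s / 2 * z ^ 2 + ν * s * (t - t₀))
    (fun y => (hasDerivAt_heatPoly_space ν c d s t₀ t y).differentiableAt) x
  rw [deriv_heatPoly_space] at h
  exact h

/-- `∇p = 0` for the zero pressure. [cite: Acheson1990, §2.3 eq. (2.9)] -/
theorem gradient_shearPressure_zero (t : ℝ) (x : E3) :
    gradient (shearPressure (fun _ => (0 : ℝ)) t) x = 0 := by
  rw [gradient_shearPressure]
  simp

/-- `∂ₜp = 0` for the zero pressure (within any time set). [cite: Acheson1990, §2.3 eq. (2.9)] -/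
theorem timeDerivWithin_shearPressure_zero (S : Set ℝ) (t : ℝ) (x : E3) :
    timeDerivWithin S (shearPressure fun _ => (0 : ℝ)) t x = 0 := by
  rw [timeDerivWithin_apply]
  simp [shearPressure]

/-- Gradient of a function of the shear coordinate alone: `∇(g(x₁)) = g′(x₁) e₁`.
[cite: Acheson1990, §2.3 eq. (2.9)] -/
theorem gradient_comp_coord_one {g : ℝ → ℝ} {x : E3} {g' : ℝ} (hg : HasDerivAt g g' (x 1)) :
    gradient (fun z : E3 => g (z 1)) x = g' • EuclideanSpace.single (1 : Fin 3) (1 : ℝ) := by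
  have h2 : HasFDerivAt (fun z : E3 => z 1) (EuclideanSpace.proj (1 : Fin 3) : E3 →L[ℝ] ℝ) x :=
    (EuclideanSpace.proj (1 : Fin 3) : E3 →L[ℝ] ℝ).hasFDerivAt
  have h := hg.comp_hasFDerivAt x h2
  have hL : g' • (EuclideanSpace.proj (1 : Fin 3) : E3 →L[ℝ] ℝ) =
      toDual ℝ E3 (g' • EuclideanSpace.single (1 : Fin 3) (1 : ℝ)) := by
    ext v
    simp [EuclideanSpace.inner_single_left]
  have hG : HasGradientAt (fun z : E3 => g (z 1)) (g' • EuclideanSpace.single (1 : Fin 3) (1 : ℝ)) x := by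
    rw [hasGradientAt_iff_hasFDerivAt, ← hL]
    exact h
  exact hG.gradient

/-- `∇(|u|²/2)(t, x) = φ φ_y e₁`; at `(t₀, 0)` it is `c d e₁`. [cite: Acheson1990, §2.3 eq. (2.8)] -/
theorem gradient_half_norm_sq_heatPolyShear_origin (ν c d s t₀ : ℝ) :
    gradient (fun z : E3 =>
        ‖shearVelocity (fun τ y => c + d * y + s / 2 * y ^ 2 + ν * s * (τ - t₀)) t₀ z‖ ^ 2 / 2) 0 =
      (c * d) • EuclideanSpace.single (1 : Fin 3) (1 : ℝ) := by
  have hfun : (fun z : E3 =>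
      ‖shearVelocity (fun τ y => c + d * y + s / 2 * y ^ 2 + ν * s * (τ - t₀)) t₀ z‖ ^ 2 / 2) =
      fun z : E3 => (fun r : ℝ => (c + d * r + s / 2 * r ^ 2 + ν * s * (t₀ - t₀)) ^ 2 / 2) (z 1) := by
    funext z
    have hn : ‖EuclideanSpace.single (0 : Fin 3) (1 : ℝ)‖ = 1 := by simp
    simp only [shearVelocity, norm_smul, hn, mul_one, Real.norm_eq_abs, sq_abs]
  rw [hfun]
  have hg : HasDerivAt (fun r : ℝ => (c + d * r + s / 2 * r ^ 2 + ν * s * (t₀ - t₀)) ^ 2 / 2)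
      (c * d) ((0 : E3) 1) := by
    have h0 : ((0 : E3) 1) = 0 := rfl
    rw [h0]
    have h1 := hasDerivAt_heatPoly_space ν c d s t₀ t₀ 0
    have h2 := (h1.pow 2).div_const 2
    refine h2.congr_deriv ?_
    simp
    ring
  exact gradient_comp_coord_one hg

/-! ### The shear slot -/

/-- **THE SHEAR SLOT.** Let `R` be any relation among the point values
`(u, ∂ₜu, (u·∇)u, Δu, ∇p, ∇(|u|²/2), Du, p, ∂ₜp)` and suppose it holds at every `(t, x)`, `t ∈ S`,
for EVERY unforced classical solution `(u, p)` with viscosity `ν` on a time set `S` of unique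
differentiability containing `t₀`. Then for all reals `c, d, s`:
`R (c e₀) (ν s e₀) 0 (s e₀) 0 (c d e₁) (d e₀ ⊗ e₁*) 0 0` — realised at `(t₀, 0)` by the polynomial
heat-profile shear flow. In words: value, shear rate and profile curvature are free, the viscous term
`νΔu = ∂ₜu` is alive while the convective term and the pressure vanish identically.
[cite: Acheson1990, §2.3 eqs. (2.8)–(2.9)] -/
theorem shearSlot {S : Set ℝ} (hS : UniqueDiffOn ℝ S) {t₀ : ℝ} (ht₀ : t₀ ∈ S) {ν : ℝ}
    {R : E3 → E3 → E3 → E3 → E3 → E3 → (E3 →L[ℝ] E3) → ℝ → ℝ → Prop}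
    (hR : ∀ (u : ℝ → E3 → E3) (p : ℝ → E3 → ℝ), IsClassicalNSSolutionOn S ν 0 u p →
      ∀ t ∈ S, ∀ x, R (u t x) (timeDerivWithin S u t x) (convect (u t) (u t) x) ((Δ (u t)) x)
        (gradient (p t) x) (gradient (fun z => ‖u t z‖ ^ 2 / 2) x) (fderiv ℝ (u t) x) (p t x)
        (timeDerivWithin S p t x))
    (c d s : ℝ) :
    R (c • EuclideanSpace.single (0 : Fin 3) (1 : ℝ)) ((ν * s) • EuclideanSpace.single (0 : Fin 3) (1 : ℝ))
      0 (s • EuclideanSpace.single (0 : Fin 3) (1 : ℝ)) 0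
      ((c * d) • EuclideanSpace.single (1 : Fin 3) (1 : ℝ))
      ((EuclideanSpace.proj (1 : Fin 3) : E3 →L[ℝ] ℝ).smulRight (d • EuclideanSpace.single (0 : Fin 3) (1 : ℝ)))
      0 0 := by
  have h := hR _ _ (isClassicalNSSolutionOn_heatPolyShear hS ν c d s t₀) t₀ ht₀ 0
  rw [heatPolyShear_apply_origin, timeDerivWithin_heatPolyShear (hS t₀ ht₀), convect_heatPolyShear,
    laplacian_heatPolyShear, gradient_shearPressure_zero, gradient_half_norm_sq_heatPolyShear_origin,
    fderiv_heatPolyShear, shearPressure_zero_apply, timeDerivWithin_shearPressure_zero] at h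
  simpa using h

/-! ### Corollaries by shape -/

/-- **No componentwise heat law `∂ₜuᵢ = β ∂ᵢ∂ᵢuᵢ`** (each component diffusing in its own variable —
the shape of `Literature.Claims.NS.Sghiar2016.Step_heat`): for `ν ≠ 0` there is no constant `β` for
which it holds for all unforced classical solutions; the shear mode has `∂ₜu₀ = ν s ≠ 0` while
`∂₀∂₀u₀ = 0` (`u` depends on `x₁` only). [cite: Acheson1990, §2.3 eq. (2.9)] -/
theorem no_componentwise_heat_law {S : Set ℝ} (hS : UniqueDiffOn ℝ S) {t₀ : ℝ} (ht₀ : t₀ ∈ S)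
    {ν : ℝ} (hν : ν ≠ 0) :
    ¬ ∃ β : ℝ, ∀ (u : ℝ → E3 → E3) (p : ℝ → E3 → ℝ), IsClassicalNSSolutionOn S ν 0 u p →
        ∀ t ∈ S, ∀ (x : E3) (i : Fin 3),
          timeDerivWithin S u t x i =
            β * fderiv ℝ (fun z : E3 => fderiv ℝ (u t) z (EuclideanSpace.single i (1 : ℝ)) i) x
              (EuclideanSpace.single i (1 : ℝ)) := by
  rintro ⟨β, hβ⟩
  set φ : ℝ → ℝ → ℝ := fun τ y => (0 : ℝ) + 0 * y + 1 / 2 * y ^ 2 + ν * 1 * (τ - t₀) with hφ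
  have h := hβ _ _ (isClassicalNSSolutionOn_heatPolyShear hS ν 0 0 1 t₀) t₀ ht₀ 0 0
  rw [timeDerivWithin_heatPolyShear (hS t₀ ht₀)] at h
  -- the inner directional derivative `∂₀u₀` vanishes identically
  have hinner : (fun z : E3 => fderiv ℝ (shearVelocity φ t₀) z (EuclideanSpace.single 0 (1 : ℝ)) 0) =
      fun _ => (0 : ℝ) := by
    funext z
    rw [hφ, fderiv_heatPolyShear]
    simp
  rw [hinner] at h
  simp at h
  exact hν h

/-- **No pressure-free pointwise energy transport `∂ₜE + u·∇E = −ν|∇u|²`, `E = ½|u|² + p`**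
(the shape of `Literature.Claims.NS.Chio2026.EnergyTransport_pt`): for `ν ≠ 0` it fails for some
unforced classical solution — on the shear flow with `(c, d, s) = (1, 0, 1)` the left side is
`⟪u, ∂ₜu⟫ = ν` and the right side is `0`. The true pointwise identity carries `ν⟪u, Δu⟫`, not
`−ν|∇u|²` (they differ by a divergence). [cite: Acheson1990, §2.3 eq. (2.9)] -/
theorem no_pressureless_energy_transport {S : Set ℝ} (hS : UniqueDiffOn ℝ S) {t₀ : ℝ} (ht₀ : t₀ ∈ S)
    {ν : ℝ} (hν : ν ≠ 0) :
    ¬ ∀ (u : ℝ → E3 → E3) (p : ℝ → E3 → ℝ), IsClassicalNSSolutionOn S ν 0 u p →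
        ∀ t ∈ S, ∀ x : E3,
          ⟪u t x, timeDerivWithin S u t x⟫ + timeDerivWithin S p t x +
              ⟪u t x, gradient (fun z => ‖u t z‖ ^ 2 / 2) x + gradient (p t) x⟫ =
            -ν * ∑ i : Fin 3, ‖fderiv ℝ (u t) x (EuclideanSpace.single i (1 : ℝ))‖ ^ 2 := by
  intro h
  have key := shearSlot hS ht₀
    (R := fun u ut _ _ gp gk Du _ pt =>
      ⟪u, ut⟫ + pt + ⟪u, gk + gp⟫ = -ν * ∑ i : Fin 3, ‖Du (EuclideanSpace.single i (1 : ℝ))‖ ^ 2)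
    (fun u p hup t ht x => h u p hup t ht x) 1 0 1
  simp [EuclideanSpace.inner_single_left] at key
  exact hν key

/-- **The viscous term is not slaved to the inertial/pressure terms**: no pointwise law
`νΔu = Ψ(u, (u·∇)u, ∇p, ∇(|u|²/2))` holds for all unforced classical solutions (`ν ≠ 0`): the
shear family keeps `u, (u·∇)u, ∇p, ∇|u|²` fixed at `(c e₀, 0, 0, 0)` (`d = 0`) while `Δu = s e₀` is
free. [cite: MajdaBertozzi2002, §1.2] -/
theorem laplacian_term_not_slaved {S : Set ℝ} (hS : UniqueDiffOn ℝ S) {t₀ : ℝ} (ht₀ : t₀ ∈ S)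
    {ν : ℝ} (hν : ν ≠ 0) :
    ¬ ∃ Ψ : E3 → E3 → E3 → E3 → E3, ∀ (u : ℝ → E3 → E3) (p : ℝ → E3 → ℝ),
        IsClassicalNSSolutionOn S ν 0 u p →
          ∀ t ∈ S, ∀ x : E3, ν • (Δ (u t)) x =
            Ψ (u t x) (convect (u t) (u t) x) (gradient (p t) x) (gradient (fun z => ‖u t z‖ ^ 2 / 2) x) := by
  rintro ⟨Ψ, hΨ⟩
  have h0 := shearSlot hS ht₀ (R := fun u _ uc lap gp gk _ _ _ => ν • lap = Ψ u uc gp gk)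
    (fun u p hup t ht x => hΨ u p hup t ht x) 0 0 0
  have h1 := shearSlot hS ht₀ (R := fun u _ uc lap gp gk _ _ _ => ν • lap = Ψ u uc gp gk)
    (fun u p hup t ht x => hΨ u p hup t ht x) 0 0 1
  simp only [zero_smul, mul_zero, smul_zero, one_smul] at h0 h1
  have : ν • EuclideanSpace.single (0 : Fin 3) (1 : ℝ) = 0 := by rw [h1, ← h0]
  rw [smul_eq_zero] at this
  rcases this with h | h
  · exact hν h
  · have := congrArg (fun v : E3 => v 0) h
    simp at this

/-! ### Second time derivative: no wave-type reformulation (appended) -/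

/-- Along the polynomial heat-profile shear flow the (one-sided) time derivative is the CONSTANT
field `ν s e₀` on the time set, so the second time derivative within `S` vanishes.
[cite: Acheson1990, §2.3 eq. (2.9)] -/
theorem timeDerivWithin_timeDerivWithin_heatPolyShear {S : Set ℝ} (hS : UniqueDiffOn ℝ S)
    {t : ℝ} (ht : t ∈ S) (ν c d s t₀ : ℝ) (x : E3) :
    timeDerivWithin S
        (timeDerivWithin S (shearVelocity fun τ y => c + d * y + s / 2 * y ^ 2 + ν * s * (τ - t₀))) t x
      = 0 := by
  rw [timeDerivWithin_apply]
  have hconst : HasDerivWithinAt (fun _ : ℝ => (ν * s) • EuclideanSpace.single (0 : Fin 3) (1 : ℝ))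
      (0 : E3) S t := hasDerivWithinAt_const _ _ _
  have hev : (fun τ => timeDerivWithin S
      (shearVelocity fun τ' y => c + d * y + s / 2 * y ^ 2 + ν * s * (τ' - t₀)) τ x) =ᶠ[nhdsWithin t S]
      fun _ => (ν * s) • EuclideanSpace.single (0 : Fin 3) (1 : ℝ) := by
    filter_upwards [self_mem_nhdsWithin] with τ hτ
    exact timeDerivWithin_heatPolyShear (hS τ hτ) ν c d s t₀ x
  have h := hconst.congr_of_eventuallyEq hev (timeDerivWithin_heatPolyShear (hS t ht) ν c d s t₀ x)
  exact h.derivWithin (hS t ht)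

/-- **No wave-type (second-order-in-time) reformulation**: for `ν ≠ 0` there is no constant `κ ≠ 0`
with `∂ₜ²u = κ Δu` for all unforced classical Navier–Stokes solutions (the «(1)–(3) are the 3-D wave
equation» identification, `Literature.Claims.NS.Tarver2016.WaveGivesNSAbs`, read in the direction
NS ⇒ wave): the heat-profile shear flow has `∂ₜ²u = 0` while `Δu = s e₀ ≠ 0`.
[cite: Acheson1990, §2.3 eq. (2.9)] -/
theorem no_wave_law {S : Set ℝ} (hS : UniqueDiffOn ℝ S) {t₀ : ℝ} (ht₀ : t₀ ∈ S) (ν : ℝ) :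
    ¬ ∃ κ : ℝ, κ ≠ 0 ∧ ∀ (u : ℝ → E3 → E3) (p : ℝ → E3 → ℝ), IsClassicalNSSolutionOn S ν 0 u p →
        ∀ t ∈ S, ∀ x : E3,
          timeDerivWithin S (timeDerivWithin S u) t x = κ • (Δ (u t)) x := by
  rintro ⟨κ, hκ, hlaw⟩
  have h := hlaw _ _ (isClassicalNSSolutionOn_heatPolyShear hS ν 0 0 1 t₀) t₀ ht₀ 0
  rw [timeDerivWithin_timeDerivWithin_heatPolyShear hS ht₀, laplacian_heatPolyShear, one_smul] at h
  have := congrArg (fun v : E3 => v 0) h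
  simp at this
  exact hκ this.symm

end ShearSlot

end Literature.Barriers.NavierStokesRegularity

end
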